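import Summits.BirchSwinnertonDyer.BirchSwinnertonDyer.Theorems.EisensteinDepletionAtTwoStarOptBNSFTwoAdicDictionary
import Literature.NumberTheory.EllipticCurves.IsogenyTwoTorsionProofs
import HarnessLib

/-!
# The 2-ADIC half of the h-invariant, étale case: the 2-isogeny with ÉTALE kernel lands on a RAMIFIED dual kernel — explicit minimal model

Support lemmas for the crux (★-OptB_NSF) `StarOptBNSF` (item stmt-BirchSwinnertonDyer-27047), line `nsf`, stub `stub_regimeTransport`
(h-invariant bookkeeping: along a rational 2-isogeny the 2-adic type of the kernel point FLIPS — Cartier duality `ℤ/2 ↔ μ₂` on an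
ordinary curve).  This file does the ÉTALE ⟶ RAMIFIED direction in coordinates, with an explicit integral model of the isogenous curve:

Let `W₀/ℤ` have odd discriminant (a model minimal at 2 with good reduction) and a rational 2-torsion point with `ξ = 4x` divisible by
`4` (ÉTALE, `TwoAdicDictionary`).  In the two-torsion normal form `E = [0, A, 0, B, 0]`, `A = b₂ + 3ξ`, `B = 3ξ² + 2b₂ξ + 8b₄`
(tree `smul_eq_twoTorsionModel`) one has `A = 4α + 1` and — from `B²(A² − 4B) = 2⁸Δ(W₀)` — `B = 16B₂` with `B₂` ODD
(`normalForm_etale`).  The codomain of the explicit 2-isogeny is `E' = [0, −2A, 0, A² − 4B, 0]` (tree `twoIsogenyCodomain`), and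
the change of variables `(u, r, s, t) = (2, 1, 1, 4α)` carries it to the INTEGRAL model
`M = [1, −2α, α, α² − α − 4B₂, −B₂]` (`smul_twoIsogenyCodomain_eq_dualModel`) whose discriminant `B₂(A² − 64B₂)²` is ODD
(`odd_Δ_dualModel`: `M` is minimal at 2 with good — indeed ordinary, `a₁ = 1` — reduction), on which the dual-kernel point `(0,0)` of `E'`
becomes `(−1/4, (1 − 4α)/8)`: abscissa `−1/4`, `ξ' = −1` odd, i.e. RAMIFIED AT 2 (`hasRationalTwoTorsionX_dualModel`,
`twoTorsionRamifiedAtTwo_dualPoint`).  (The ramified ⟶ étale direction is analogous with `(u, r, s, t) = (4, 0, 2, 0)`; not in this file.)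

HONEST FRAMING: coordinates only; the identification of `M` with «the» globally minimal model of `E/⟨T⟩` (unique up to `u = ±1`,
`r, s, t ∈ ℤ`, which preserves `v₂(x) < 0`) and the isogeny-class walk are not here; nothing proves `StarOptBNSF`, E1M_NSF or BSD.
References: J. Silverman, AEC III.1 Table 3.1, III.4 Example 4.5, VII.1 [SilvermanAEC2009]; W. Ivorra, Dissertationes Math. 429 (2004) §2.1
[Ivorra2004]; R. Greenberg, LNM 1716 (1999) §5 [GreenbergLNM1716].
-/

set_option linter.dupNamespace false
set_option autoImplicit false

open Literature.NumberTheory.EllipticCurves Literature.NumberTheory.EllipticCurves.Greenberg1999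
  Literature.NumberTheory.EllipticCurves.PrimeConductorTwoTorsion
  Summit.BirchSwinnertonDyer.BirchSwinnertonDyer.Theorems.DepletionAtTwo.TwoAdic

namespace Summit.BirchSwinnertonDyer.BirchSwinnertonDyer.Theorems.DepletionAtTwo.TwoAdicFlip

/-! ## §1 The étale normal form: `A = 4α + 1`, `B = 16B₂`, `B₂` odd -/

/-- **`B²(A² − 4B) = 2⁸·Δ(W₀)`** for the two-torsion normal form `[0, A, 0, B, 0]` attached to an integer root `ξ` (`x₀ = ξ/4`):
`Δ` scales by `u⁻¹² = 2¹²` under `u = 1/2` and `Δ([0,A,0,B,0]) = 16B²(A² − 4B)`. [cite: SilvermanAEC2009, III.1 Table 3.1] -/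
theorem normalForm_Δ (W₀ : WeierstrassCurve ℤ) {ξ : ℤ}
    (H : ξ ^ 3 + W₀.b₂ * ξ ^ 2 + 8 * W₀.b₄ * ξ + 16 * W₀.b₆ = 0) :
    (3 * ξ ^ 2 + 2 * W₀.b₂ * ξ + 8 * W₀.b₄) ^ 2 * ((W₀.b₂ + 3 * ξ) ^ 2 - 4 * (3 * ξ ^ 2 + 2 * W₀.b₂ * ξ + 8 * W₀.b₄)) =
      256 * W₀.Δ := by
  obtain ⟨y₀, heq, h2⟩ := hasRationalTwoTorsionX_of_root W₀ H
  set W : WeierstrassCurve ℚ := W₀.baseChange ℚ with hW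
  have hsmul := smul_eq_twoTorsionModel W heq h2
  have hΔ := congrArg WeierstrassCurve.Δ hsmul
  rw [WeierstrassCurve.variableChange_Δ, Δ_twoTorsionModel] at hΔ
  have hu : ((((⟨1 / 2, 2, by norm_num, by norm_num⟩ : ℚˣ)⁻¹ : ℚˣ) : ℚ)) = 2 := rfl
  rw [hu] at hΔ
  have hWΔ : W.Δ = (W₀.Δ : ℚ) := by simp [hW, WeierstrassCurve.baseChange]
  have hb₂ : W.b₂ = (W₀.b₂ : ℚ) := by simp [hW, WeierstrassCurve.baseChange]
  have hb₄ : W.b₄ = (W₀.b₄ : ℚ) := by simp [hW, WeierstrassCurve.baseChange]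
  rw [hWΔ, hb₂, hb₄] at hΔ
  have hx : (4 : ℚ) * ((ξ : ℚ) / 4) = ξ := by ring
  rw [hx] at hΔ
  have : ((3 * ξ ^ 2 + 2 * W₀.b₂ * ξ + 8 * W₀.b₄) ^ 2 * ((W₀.b₂ + 3 * ξ) ^ 2 - 4 * (3 * ξ ^ 2 + 2 * W₀.b₂ * ξ + 8 * W₀.b₄)) : ℚ) =
      (256 * W₀.Δ : ℚ) := by
    linear_combination (-1 / 16 : ℚ) * hΔ
  exact_mod_cast this

/-- **The étale normal form.** For `W₀/ℤ` with odd discriminant and an integer root `ξ` with `4 ∣ ξ` (an ÉTALE rational 2-torsion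
point): `A = b₂ + 3ξ = 4α + 1` and `B = 3ξ² + 2b₂ξ + 8b₄ = 16B₂` with `B₂` odd. (`a₁` is odd, so `b₂ ≡ 1 (4)`, `8 ∣ B` — tree
`typeI`; then `B²(A² − 4B) = 2⁸Δ` with `Δ`, `A² − 4B` odd forces `v₂(B) = 4`.) [cite: Ivorra2004, §2.1] -/
theorem normalForm_etale (W₀ : WeierstrassCurve ℤ) (hΔ : Odd W₀.Δ) {ξ : ℤ}
    (H : ξ ^ 3 + W₀.b₂ * ξ ^ 2 + 8 * W₀.b₄ * ξ + 16 * W₀.b₆ = 0) (h4 : (4 : ℤ) ∣ ξ) :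
    ∃ α B₂ : ℤ, W₀.b₂ + 3 * ξ = 4 * α + 1 ∧ 3 * ξ ^ 2 + 2 * W₀.b₂ * ξ + 8 * W₀.b₄ = 16 * B₂ ∧ Odd B₂ := by
  -- `a₁` odd (an even `a₁` with odd `Δ` forces `a₃` odd, and then there is no integer root)
  have ha₁ : Odd W₀.a₁ := by
    rcases odd_a₁_or_odd_a₃_of_odd_Δ W₀ hΔ with h₁ | h₃
    · exact h₁
    · rcases Int.even_or_odd W₀.a₁ with h₁ | h₁
      · exact absurd H (no_root_of_even_a₁_odd_a₃ W₀ h₁ h₃ ξ)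
      · exact h₁
  obtain ⟨e, he⟩ := b₂_eq_of_odd_a₁ W₀ ha₁
  obtain ⟨hA, B₁, hB₁⟩ := typeI W₀.b₂ W₀.b₄ W₀.a₂ e ξ he h4
  have hId := normalForm_Δ W₀ H
  rw [hB₁] at hId
  obtain ⟨d, hd⟩ := hΔ
  have hAodd : Odd (W₀.b₂ + 3 * ξ) := Int.odd_iff.mpr (by omega)
  -- Step 1: `B₁` is even (else `64·odd = 256·Δ`)
  have hB₁even : Even B₁ := by
    by_contra hodd
    rw [Int.not_even_iff_odd] at hodd
    have hoddprod : Odd (B₁ ^ 2 * ((W₀.b₂ + 3 * ξ) ^ 2 - 32 * B₁)) := by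
      refine Int.odd_mul.mpr ⟨Int.odd_pow.mpr (Or.inl hodd), ?_⟩
      rw [Int.odd_sub]
      exact ⟨fun _ ↦ ⟨16 * B₁, by ring⟩, fun _ ↦ Int.odd_pow.mpr (Or.inl hAodd)⟩
    obtain ⟨k, hk⟩ := hoddprod
    have e64 : (8 * B₁) ^ 2 * ((W₀.b₂ + 3 * ξ) ^ 2 - 4 * (8 * B₁)) = 64 * (B₁ ^ 2 * ((W₀.b₂ + 3 * ξ) ^ 2 - 32 * B₁)) := by ring
    rw [e64, hk, hd] at hId
    omega
  obtain ⟨c, hc⟩ := hB₁even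
  -- Step 2: `c` is odd (`c²(A² − 64c) = Δ`)
  have key : 256 * (c ^ 2 * ((W₀.b₂ + 3 * ξ) ^ 2 - 64 * c)) = 256 * W₀.Δ := by
    rw [← hId, hc]; ring
  have key' : c ^ 2 * ((W₀.b₂ + 3 * ξ) ^ 2 - 64 * c) = W₀.Δ := by omega
  have hcodd : Odd c := by
    by_contra hce
    rw [Int.not_odd_iff_even] at hce
    obtain ⟨m, hm⟩ := hce
    have e4 : c ^ 2 * ((W₀.b₂ + 3 * ξ) ^ 2 - 64 * c) = 4 * (m ^ 2 * ((W₀.b₂ + 3 * ξ) ^ 2 - 64 * c)) := by rw [hm]; ring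
    rw [e4, hd] at key'
    generalize m ^ 2 * ((W₀.b₂ + 3 * ξ) ^ 2 - 64 * c) = Y at key'
    omega
  exact ⟨(W₀.b₂ + 3 * ξ) / 4, c, by omega, by rw [hB₁, hc]; ring, hcodd⟩

/-! ## §2 The dual model `M = [1, −2α, α, α² − α − 4B₂, −B₂]` and its ramified point `(−1/4, (1 − 4α)/8)` -/

/-- **`(u, r, s, t) = (2, 1, 1, 4α)` carries `E' = twoIsogenyCodomain [0, 4α+1, 0, 16B₂, 0] = [0, −2(4α+1), 0, (4α+1)² − 64B₂, 0]`
to `M(α, B₂) ⊗ ℚ`, `M(α, B₂) := [1, −2α, α, α² − α − 4B₂, −B₂]`.** [cite: SilvermanAEC2009, III.1 Table 3.1 and III.4 Example 4.5] -/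
theorem smul_twoIsogenyCodomain_eq_dualModel (α B₂ : ℤ) :
    (⟨⟨2, 1 / 2, by norm_num, by norm_num⟩, 1, 1, 4 * (α : ℚ)⟩ : WeierstrassCurve.VariableChange ℚ) •
        WeierstrassCurve.twoIsogenyCodomain (⟨0, 4 * (α : ℚ) + 1, 0, 16 * (B₂ : ℚ), 0⟩ : WeierstrassCurve ℚ) =
      (⟨1, -2 * α, α, α ^ 2 - α - 4 * B₂, -B₂⟩ : WeierstrassCurve ℤ).baseChange ℚ := by
  have hu : ((((⟨2, 1 / 2, by norm_num, by norm_num⟩ : ℚˣ)⁻¹ : ℚˣ) : ℚ)) = 1 / 2 := rfl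
  ext
  · rw [WeierstrassCurve.variableChange_a₁, hu]; simp [WeierstrassCurve.twoIsogenyCodomain, WeierstrassCurve.baseChange]
  · rw [WeierstrassCurve.variableChange_a₂, hu]
    simp [WeierstrassCurve.twoIsogenyCodomain, WeierstrassCurve.baseChange]; ring
  · rw [WeierstrassCurve.variableChange_a₃, hu]
    simp [WeierstrassCurve.twoIsogenyCodomain, WeierstrassCurve.baseChange]; ring
  · rw [WeierstrassCurve.variableChange_a₄, hu]
    simp [WeierstrassCurve.twoIsogenyCodomain, WeierstrassCurve.baseChange]; ring
  · rw [WeierstrassCurve.variableChange_a₆, hu]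
    simp [WeierstrassCurve.twoIsogenyCodomain, WeierstrassCurve.baseChange]; ring

/-- **`Δ(M) = B₂·((4α+1)² − 64B₂)²`** — odd when `B₂` is odd: `M` is minimal at 2 with good (ordinary, `a₁ = 1`) reduction.
[cite: SilvermanAEC2009, III.1 (Δ) and VII.1 Remark 1.1] -/
theorem Δ_dualModel (α B₂ : ℤ) : (⟨1, -2 * α, α, α ^ 2 - α - 4 * B₂, -B₂⟩ : WeierstrassCurve ℤ).Δ = B₂ * ((4 * α + 1) ^ 2 - 64 * B₂) ^ 2 := by
  simp only [WeierstrassCurve.Δ, WeierstrassCurve.b₂, WeierstrassCurve.b₄, WeierstrassCurve.b₆, WeierstrassCurve.b₈]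
  ring

/-- `Δ(M)` is odd when `B₂` is. [folklore] -/
theorem odd_Δ_dualModel (α B₂ : ℤ) (hB₂ : Odd B₂) : Odd (⟨1, -2 * α, α, α ^ 2 - α - 4 * B₂, -B₂⟩ : WeierstrassCurve ℤ).Δ := by
  rw [Δ_dualModel]
  refine Int.odd_mul.mpr ⟨hB₂, Int.odd_pow.mpr (Or.inl ?_)⟩
  rw [Int.odd_sub]
  exact ⟨fun _ ↦ ⟨32 * B₂, by ring⟩, fun _ ↦ Int.odd_pow.mpr (Or.inl ⟨2 * α, by ring⟩)⟩

/-- **The dual-kernel point on `M`**: `(−1/4, (1 − 4α)/8)` is a rational point of order 2 of `M ⊗ ℚ` (it is the image of `(0,0) ∈ E'`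
under `(2, 1, 1, 4α)`: `x' = (0 − 1)/2²`). [cite: SilvermanAEC2009, III.4 Example 4.5] -/
theorem hasRationalTwoTorsionX_dualModel (α B₂ : ℤ) :
    HasRationalTwoTorsionX ((⟨1, -2 * α, α, α ^ 2 - α - 4 * B₂, -B₂⟩ : WeierstrassCurve ℤ).baseChange ℚ) (-1 / 4) := by
  refine ⟨(1 - 4 * (α : ℚ)) / 8, ?_, ?_⟩
  · rw [WeierstrassCurve.Affine.equation_iff]
    simp [WeierstrassCurve.baseChange]
    ring
  · simp [WeierstrassCurve.baseChange]
    ring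

/-- **… and it is RAMIFIED at 2**: `ξ' = 4·(−1/4) = −1` is odd, `v₂(−1/4) = −2 < 0`. [cite: GreenbergLNM1716, §5 (chunk p0168)] -/
theorem twoTorsionRamifiedAtTwo_dualPoint : TwoTorsionRamifiedAtTwo (-1 / 4 : ℚ) := by
  rw [twoTorsionRamifiedAtTwo_iff]
  have h : (-1 / 4 : ℚ) = ((-1 : ℤ) : ℚ) / 4 := by norm_num
  rw [h, padicValRat_intCast_div_four (by norm_num), padicValRat.of_int,
    padicValInt.eq_zero_of_not_dvd (by decide)]
  norm_num

/-! ## §3 Assembly: from an étale rational 2-torsion point of `W₀` to the ramified dual point on the minimal model of the 2-isogenous curve -/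

/-- **THE 2-ADIC FLIP, ÉTALE ⟶ RAMIFIED (explicit).**  Let `W₀/ℤ` have odd discriminant and a rational 2-torsion point `x₀` of
`W₀ ⊗ ℚ` NOT ramified at 2.  Then there are integers `α`, `B₂` (`B₂` odd) such that: the two-torsion normal form of `(W₀, x₀)` is
`E = [0, 4α+1, 0, 16B₂, 0]` (reached by `(u,r,s,t) = (1/2, x₀, −a₁/2, y₀)`), the codomain `E' = twoIsogenyCodomain E` of the explicit
2-isogeny with kernel `⟨(x₀, y₀)⟩` is carried by `(2, 1, 1, 4α)` to the integral model `M(α, B₂)` with ODD discriminant, and the dual-kernel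
point of `M ⊗ ℚ` has abscissa `−1/4`, which IS ramified at 2. [cite: SilvermanAEC2009, III.4 Example 4.5, VII.1] [cite: GreenbergLNM1716, §5] -/
theorem flip_etale_to_ramified (W₀ : WeierstrassCurve ℤ) (hΔ : Odd W₀.Δ) {x₀ : ℚ}
    (hx₀ : HasRationalTwoTorsionX (W₀.baseChange ℚ) x₀) (het : ¬ TwoTorsionRamifiedAtTwo x₀) :
    ∃ (α B₂ : ℤ) (y₀ : ℚ), Odd B₂ ∧
      (W₀.baseChange ℚ).toAffine.Equation x₀ y₀ ∧ 2 * y₀ + (W₀.baseChange ℚ).a₁ * x₀ + (W₀.baseChange ℚ).a₃ = 0 ∧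
      (⟨⟨1 / 2, 2, by norm_num, by norm_num⟩, x₀, -(W₀.baseChange ℚ).a₁ / 2, y₀⟩ : WeierstrassCurve.VariableChange ℚ) •
          W₀.baseChange ℚ = ⟨0, 4 * (α : ℚ) + 1, 0, 16 * (B₂ : ℚ), 0⟩ ∧
      (⟨⟨2, 1 / 2, by norm_num, by norm_num⟩, 1, 1, 4 * (α : ℚ)⟩ : WeierstrassCurve.VariableChange ℚ) •
          WeierstrassCurve.twoIsogenyCodomain (⟨0, 4 * (α : ℚ) + 1, 0, 16 * (B₂ : ℚ), 0⟩ : WeierstrassCurve ℚ) =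
        (⟨1, -2 * α, α, α ^ 2 - α - 4 * B₂, -B₂⟩ : WeierstrassCurve ℤ).baseChange ℚ ∧
      Odd (⟨1, -2 * α, α, α ^ 2 - α - 4 * B₂, -B₂⟩ : WeierstrassCurve ℤ).Δ ∧
      HasRationalTwoTorsionX ((⟨1, -2 * α, α, α ^ 2 - α - 4 * B₂, -B₂⟩ : WeierstrassCurve ℤ).baseChange ℚ) (-1 / 4) ∧ TwoTorsionRamifiedAtTwo (-1 / 4 : ℚ) := by
  have hb : Odd W₀.b₂ := odd_b₂_of_odd_Δ_of_hasRationalTwoTorsionX W₀ hΔ hx₀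
  obtain ⟨ξ, hξ, H, hiff⟩ := exists_four_mul_and_ramified_iff_odd W₀ hb hx₀
  have h4 : (4 : ℤ) ∣ ξ := by
    rcases odd_or_four_dvd W₀.b₂ W₀.b₄ W₀.b₆ ξ hb H with ⟨hodd, -⟩ | h4
    · exact absurd (hiff.mpr hodd) het
    · exact h4
  obtain ⟨α, B₂, hA, hB, hB₂⟩ := normalForm_etale W₀ hΔ H h4
  obtain ⟨y₀, heq, h2⟩ := hx₀
  refine ⟨α, B₂, y₀, hB₂, heq, h2, ?_, smul_twoIsogenyCodomain_eq_dualModel α B₂, odd_Δ_dualModel α B₂ hB₂,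
    hasRationalTwoTorsionX_dualModel α B₂, twoTorsionRamifiedAtTwo_dualPoint⟩
  rw [smul_eq_twoTorsionModel (W₀.baseChange ℚ) heq h2]
  have hb₂ : (W₀.baseChange ℚ).b₂ = (W₀.b₂ : ℚ) := by simp [WeierstrassCurve.baseChange]
  have hb₄ : (W₀.baseChange ℚ).b₄ = (W₀.b₄ : ℚ) := by simp [WeierstrassCurve.baseChange]
  have hx : (4 : ℚ) * x₀ = ξ := by rw [hξ]
  rw [hb₂, hb₄, hx]
  have hA' : ((W₀.b₂ : ℚ) + 3 * ξ) = 4 * α + 1 := by exact_mod_cast hA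
  have hB' : (3 * (ξ : ℚ) ^ 2 + 2 * W₀.b₂ * ξ + 8 * W₀.b₄) = 16 * B₂ := by exact_mod_cast hB
  rw [hA', hB']

end Summit.BirchSwinnertonDyer.BirchSwinnertonDyer.Theorems.DepletionAtTwo.TwoAdicFlip
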